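import Literature.AnabelianGeometry.EtaleTheta.Discharge.Sec4CyclotomicLawBaseFieldHull
import Literature.AnabelianGeometry.EtaleTheta.Discharge.Sec5BaseFieldHullDictionaryFacts
import Literature.AnabelianGeometry.EtaleTheta.Discharge.Sec5Prop42iiiAtBaseFieldHullSetting
import Mathlib.FieldTheory.Normal.Closure
import HarnessLib

/-!
# [EtTh] Prop. 4.2 (iii) ∧ (iv) AT THE BASE-FIELD-THEORETIC HULL with the CONTENTFUL Def. 5.4 `(N,H)`-slot «the base's Galois image FIXES
# the Kummer field» — the slot is INHABITED (Kummer coverings), (iii) AND (iv) AS TYPED hold, `hL` and `roots_of_K` are theorems — PROOF-ONLY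

S. Mochizuki, *The étale theta function and its Frobenioid-theoretic manifestations*, Publ. RIMS **45** (2009) [MochizukiEtTh2009],
Prop. 4.2 (iii)(iv) pp.314–315 (PDF pp.88–89), proof p.315 (PDF p.89) («after passing to an appropriate tempered covering … `μ_N`-saturated»;
«admits an `N`-th root over some tempered covering»); §1 p.240 (PDF p.14) («`J_N := K_N(a^{1/N})_{a ∈ K_N}` … `K_N^×/(K_N^×)^N`, hence also
`Gal(J_N/K_N)`, is finite»); Def. 5.4 p.327 (PDF p.101) (theta-saturated `(N,H)`-objects: base field ⊇ the Kummer field); Lem. 5.8 p.331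
(PDF p.105) («`(K^×)^{1/N} ⊆ O^×(B_N^birat)`»).  [cite: MochizukiEtTh2009, Prop 4.2 (iii)(iv) p.314 (PDF p.88); Def 5.4 p.327 (PDF p.101)]

abc-iut cell, layer L2, seat abc-iut-f-142 (gen 10); row (c-iv) «DEF 5.4 NH-SLOT ⇒ PROP 4.2 (iv)/hL + 'roots_of_K' AT THE BASE-FIELD HULL»
(abc-iut-L2-lead R1372 recipe, R1446 succession), after abc-iut-L2-d3 g10's junction (c-iii) (p511174 `prop42_iii_mkOfConnectedTemperoid_trivNH`,
p511849, p512611) and design memo `F3B-DESIGN.md` «UPDATE 08:10:54Z».  PROOF-ONLY (0 definitions, no `Prop`-valued definition, no instance, no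
notation, no sorry; nothing landed is edited) over abc-iut-L2-d3's hull `BsFldHull.temperedFrobenioid p a ha hΓ R S` (p500929: the tempered Frobenioid
over the GENUINE base `B^temp(Γ)⁰` whose functions `B₀(Γ/U) ≅ K_U^×` are genuine `ℚ̄_p`-constants, `K_U := ℚ̄_p^{a(U)}`):
* §1 THE SLOT.  For an object `A_⊙^{bs} = Γ/U₀` put `K₀ := K_{U₀}` and, for `N ≥ 1`, `E_N(K₀) :=` the NORMAL CLOSURE over `ℚ_p` of the Kummer field
  `J_N(K₀) := K₀({x | x^N ∈ K₀})` — finite over `ℚ_p` (`K₀/ℚ_p` finite: open image; abc-iut-L2-t11's `finiteDimensional_adjoin_pow_mem`; Mathlib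
  `normalClosure`).  The `(N,H)`-slot of record here: «`A` is `(N,H)`-good iff `a(U_A) ≤ Gal(ℚ̄_p/E_N(K₀))`» (R1372's `(sgOf A).sg.map a ≤ (J N).fixingSubgroup`
  with `J N` replaced by its normal closure — REQUIRED for the translates `a(g)·c^{1/N}` along morphisms `A^{bs} → A_⊙^{bs}` with base point `g·U₀`
  when `a(Π) ⊄ G_{K₀}`; when `a(Π) ≤ G_{K₀}` the Kummer field is already `a(Π)`-stable).  `map_le_fixingSubgroup_adjoin_of_fixingSlot`: a good
  object is theta-saturated for EVERY `K ≤ K₀` in the shape `hU` of p503039, whence **`roots_of_K`** (`exists_ev_pow_eq_of_fixingSlot`) and `μ_N ⊆ K_{U_A}`.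
  **THE SLOT IS INHABITED** (`exists_galoisCover_map_le_fixingSubgroup`): every Galois `Y` is dominated by a Galois `Y′ → Y` with `a(U′) ≤ G_{E_N}`
  (abc-iut-L2-d3's `exists_galoisCover_apply_mem_fixFld` with `E := E_N`; normality ⇒ `a(γ)·E_N = E_N`).
* §2 Over a good object: the `N`-torsion of `Ker Div_B` is cyclic of order `N` (`cyclic_torsion_of_map_le_fixingSubgroup`, `ζ_N ∈ E_N`) and —
  **`hL` (G-w4d044-1) AS A THEOREM** — along every `g : A^{bs} → A_⊙^{bs}` every `ξ ∈ B(A_⊙^{bs})` becomes an `N`-th power in `B(A^{bs})`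
  (`exists_pow_eq_pull_of_map_le_fixingSubgroup`: root = the constant `a(h)·c^{1/N} ∈ E_N ⊆ K_{U_A}`, checked at the base point through the engine
  dictionary `ratFnOfBZero_natural` / `ev_pullFun`; NO divisor hypothesis needed — all constants acquire roots).
* §3 **`prop42_iii_iv_mkOfConnectedTemperoid_fixingSlot`** — [EtTh] Prop. 4.2 (iii) AND (iv) AS TYPED (`BiKummerSetting.Prop42_iii` ∧ `Prop42_iv`)
  for abc-iut-L2-t4's §4 setting `mkOfConnectedTemperoid X (hull) rfl hP NH A_⊙ …` over `B^temp(Π^tp_X)⁰` with THIS slot, for EVERY continuous `a`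
  with open images and EVERY pre-root object `A_⊙`: abc-iut-w4-d044's closer (`…_of_baseRootLaw_treeCatVocabWeak`, abc-iut-w6-d037) with EVERY binder a
  theorem — `hDSpull`, `hR₀ = BaseRootLaw «Galois»` (p508246), `hE` via abc-iut-w6-d037's `refinementLaw_mkOfModelCanonical_of_cyclotomicLaw` from §1–§2,
  `hS` (abc-iut-L2-t4's `mkOfConnectedTemperoid_galoisSurj_natural`), `hL` (§2).  The first carrier where (iii) AND (iv) AS TYPED are theorems
  with a contentful `(N,H)`-slot (the tower/small-index carriers use `NH := True` or the roots reading at design sockets).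
HONEST FRAMING: classical Kummer/cyclotomic theory of `ℚ̄_p/ℚ_p` at a carrier with genuine constants and degenerate divisor geometry (one prime per
object; the hull's rational functions ARE constants); nothing asserts that this carrier is print's tempered Frobenioid of a curve; nothing of [EtTh]
beyond the typed statements is asserted; nothing here bears on [IUTchIII] Cor. 3.12; no side taken; typed ≠ proved elsewhere.
-/

noncomputable section

namespace Literature.AnabelianGeometry.EtaleTheta

open CategoryTheory Opposite Function Literature.AlgebraicGeometry.Frobenioids Literature.AnabelianGeometry.SemiGraphs
  Literature.AlgebraicGeometry.Frobenioids.RationalOrd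

namespace BsFldHull

section Hull

variable (p : ℕ) [Fact p.Prime] {Γ : Type} [Group Γ] [TopologicalSpace Γ] (a : Γ →* GQp p)
  (ha : ∀ U : OpenSubgroup Γ, IsOpen ((U.toSubgroup.map a : Subgroup (GQp p)) : Set (GQp p)))

/-! ## §1 The normal Kummer field `E_N(K₀) ⊇ J_N(K₀) = K₀((K₀^×)^{1/N})` and what its fixing subgroups fix -/

/-- **Constants fixed by `a(U)`**: if `a(U) ≤ Gal(ℚ̄_p/F)` then `F ⊆ K_U`. [cite: MochizukiEtTh2009, Def 5.4 p.327 (PDF p.101)] -/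
theorem le_fixFld_of_map_le_fixingSubgroup (U : OpenSubgroup Γ) {F : IntermediateField ℚ_[p] (PadicAlgCl p)}
    (hU : (U.toSubgroup.map a : Subgroup (GQp p)) ≤ F.fixingSubgroup) : F ≤ fixFld p a U := by
  intro x hx
  rw [mem_fixFld_iff]
  intro u hu
  exact (IntermediateField.mem_fixingSubgroup_iff _ _).mp (hU (Subgroup.mem_map_of_mem a hu)) x hx

/-- **Every `N`-th root of unity lies in the normal closure `E_N` of `J_N(K₀) = K₀({x | x^N ∈ K₀})`** (`ζ^N = 1 ∈ K₀`).
[cite: MochizukiEtTh2009, §1 p.240 (PDF p.14)] -/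
theorem mem_normalClosure_adjoin_of_pow_eq_one (K₀ : IntermediateField ℚ_[p] (PadicAlgCl p)) (N : ℕ+) {ζ : PadicAlgCl p}
    (hζ : ζ ^ (N : ℕ) = 1) :
    ζ ∈ IntermediateField.normalClosure ℚ_[p]
      (IntermediateField.adjoin ℚ_[p] ((K₀ : Set (PadicAlgCl p)) ∪ {x | x ^ (N : ℕ) ∈ K₀})) (PadicAlgCl p) :=
  IntermediateField.le_normalClosure _ (pow_mem_adjoin_of_pow_mem p K₀ N (by rw [hζ]; exact one_mem _))

/-- **Every Galois translate `σ·z` of an `N`-th root `z` of a constant `c ∈ K₀` lies in `E_N`** (`z ∈ J_N ≤ E_N`, and `E_N/ℚ_p` is NORMAL —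
this is why the normal closure, i.e. `J_N` together with its conjugates, is the right Def. 5.4 field for ARBITRARY translates; when
`a(Π) ≤ G_{K₀}` the translates by `a(Π)` already preserve `J_N`).  [cite: MochizukiEtTh2009, §1 p.240 (PDF p.14)] -/
theorem smul_mem_normalClosure_adjoin_of_pow_mem (K₀ : IntermediateField ℚ_[p] (PadicAlgCl p)) (N : ℕ+) (σ : GQp p)
    {z : PadicAlgCl p} (hz : z ^ (N : ℕ) ∈ K₀) :
    σ z ∈ IntermediateField.normalClosure ℚ_[p]
      (IntermediateField.adjoin ℚ_[p] ((K₀ : Set (PadicAlgCl p)) ∪ {x | x ^ (N : ℕ) ∈ K₀})) (PadicAlgCl p) :=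
  (IntermediateField.normal_iff_forall_map_le'.mp inferInstance σ)
    ⟨z, IntermediateField.le_normalClosure _ (pow_mem_adjoin_of_pow_mem p K₀ N hz), rfl⟩

/-- **An `E_N(K₀)`-fixing object is THETA-SATURATED for every `K ≤ K₀`** in the shape the `ConstantsDictionary` laws consume
(`a(U_A) ≤ Gal(ℚ̄_p/J_N(K))`, the hypothesis `hU` of `exists_ev_pow_eq` / `mem_fixFld_of_pow_eq_one`, p503039): `J_N(K) ≤ J_N(K₀) ≤ E_N(K₀)`
and fixing subgroups are antitone.  [cite: MochizukiEtTh2009, Def 5.4 p.327 (PDF p.101)] -/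
theorem map_le_fixingSubgroup_adjoin_of_fixingSlot {K K₀ : IntermediateField ℚ_[p] (PadicAlgCl p)} (hK : K ≤ K₀) (N : ℕ+)
    (U : OpenSubgroup Γ)
    (hfix : (U.toSubgroup.map a : Subgroup (GQp p)) ≤
      (IntermediateField.normalClosure ℚ_[p]
        (IntermediateField.adjoin ℚ_[p] ((K₀ : Set (PadicAlgCl p)) ∪ {x | x ^ (N : ℕ) ∈ K₀})) (PadicAlgCl p)).fixingSubgroup) :
    (U.toSubgroup.map a : Subgroup (GQp p)) ≤
      (IntermediateField.adjoin ℚ_[p] ((K : Set (PadicAlgCl p)) ∪ {x | x ^ (N : ℕ) ∈ K})).fixingSubgroup := by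
  refine hfix.trans (IntermediateField.fixingSubgroup_le ((IntermediateField.adjoin.mono ℚ_[p] _ _ ?_).trans
    (IntermediateField.le_normalClosure _)))
  rintro x (hx | hx)
  · exact Or.inl (hK hx)
  · exact Or.inr (hK hx)

/-- **`roots_of_K` over an `(N,H)`-good object**: if `a(U_A)` fixes `E_N(K₀)` and `K ≤ K₀`, every `y ∈ K^×` is the `N`-th power of (the value of)
a constant function of `Γ/U_A` (Lemma 5.8 «`(K^×)^{1/N} ⊆ O^×(B_N^birat)`»; p503039's `exists_ev_pow_eq` at the slot).
[cite: MochizukiEtTh2009, Lem 5.8 p.331 (PDF p.105); Def 5.4 p.327 (PDF p.101)] -/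
theorem exists_ev_pow_eq_of_fixingSlot {K K₀ : IntermediateField ℚ_[p] (PadicAlgCl p)} (hK : K ≤ K₀) (N : ℕ+) (U : CosetCat Γ)
    (hfix : (U.sg.toSubgroup.map a : Subgroup (GQp p)) ≤
      (IntermediateField.normalClosure ℚ_[p]
        (IntermediateField.adjoin ℚ_[p] ((K₀ : Set (PadicAlgCl p)) ∪ {x | x ^ (N : ℕ) ∈ K₀})) (PadicAlgCl p)).fixingSubgroup)
    (y : (PadicAlgCl p)ˣ) (hy : (y : PadicAlgCl p) ∈ K) :
    ∃ b : eqvFun p a U, ((ev p a U b : (PadicAlgCl p)ˣ) : PadicAlgCl p) ^ (N : ℕ) = y :=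
  exists_ev_pow_eq p a K N U (map_le_fixingSubgroup_adjoin_of_fixingSlot p a hK N U.sg hfix) y hy

variable [IsTopologicalGroup Γ] (hΓ : IsTempered Γ)

include ha in
/-- **THE Def. 5.4 SLOT IS INHABITED — the Kummer covering of a Galois object**: for `a` continuous with open images, `N ≥ 1`, `U₀` open and
`Y ∈ B^temp(Γ)⁰` Galois, there is a Galois `Y′ → Y` with `a(U′) ≤ Gal(ℚ̄_p/E_N)`, `E_N` the normal closure of the Kummer field
`J_N := K_{U₀}((K_{U₀}^×)^{1/N})` — FINITE over `ℚ_p` (`K_{U₀}/ℚ_p` finite: open image; `K^×/(K^×)^N` finite: abc-iut-L2-t11's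
`finiteDimensional_adjoin_pow_mem`; Mathlib `normalClosure.is_finiteDimensional`), so `exists_galoisCover_apply_mem_fixFld` dominates
`U ∩ a⁻¹(G_{E_N})` by a Galois object; `E_N` normal ⇒ `a(γ)·E_N = E_N` is fixed by `a(U′)`.
[cite: MochizukiEtTh2009, §1 p.240 (PDF p.14); Prop 4.2 (iii) p.315 (PDF p.89); Def 5.4 p.327 (PDF p.101)] -/
theorem exists_galoisCover_map_le_fixingSubgroup (hcont : Continuous a) (N : ℕ+) (U₀ : OpenSubgroup Γ)
    (Y : ConnectedPart (BTemp Γ)) (hY : IsGaloisObj Y.obj) :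
    ∃ (Y' : ConnectedPart (BTemp Γ)) (_ : IsGaloisObj Y'.obj) (_ : Y' ⟶ Y),
      ((((CosetCat.equivConnectedPart hΓ).inverse.obj Y').sg.toSubgroup.map a : Subgroup (GQp p)) ≤
        (IntermediateField.normalClosure ℚ_[p]
          (IntermediateField.adjoin ℚ_[p] ((fixFld p a U₀ : Set (PadicAlgCl p)) ∪ {x | x ^ (N : ℕ) ∈ fixFld p a U₀}))
          (PadicAlgCl p)).fixingSubgroup) := by
  haveI : FiniteDimensional ℚ_[p] (fixFld p a U₀) := finiteDimensional_fixFld p a ha U₀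
  haveI : FiniteDimensional ℚ_[p]
      (IntermediateField.adjoin ℚ_[p] ((fixFld p a U₀ : Set (PadicAlgCl p)) ∪ {x | x ^ (N : ℕ) ∈ fixFld p a U₀})) :=
    finiteDimensional_adjoin_pow_mem (fixFld p a U₀) N
  set E : IntermediateField ℚ_[p] (PadicAlgCl p) := IntermediateField.normalClosure ℚ_[p]
    (IntermediateField.adjoin ℚ_[p] ((fixFld p a U₀ : Set (PadicAlgCl p)) ∪ {x | x ^ (N : ℕ) ∈ fixFld p a U₀})) (PadicAlgCl p)
    with hE
  have hEnorm : ∀ (σ : GQp p) (x : PadicAlgCl p), x ∈ E → σ x ∈ E := fun σ x hx =>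
    (IntermediateField.normal_iff_forall_map_le'.mp inferInstance σ) ⟨x, hx, rfl⟩
  obtain ⟨Y', hY', c, γ, hγ⟩ := exists_galoisCover_apply_mem_fixFld p a hΓ hcont E Y hY
  refine ⟨Y', hY', c, ?_⟩
  rintro _ ⟨u, hu, rfl⟩
  rw [IntermediateField.mem_fixingSubgroup_iff]
  intro y hy
  -- `y = a(γ)·(a(γ)⁻¹·y)` with `a(γ)⁻¹·y ∈ E`, and `a(γ)·E ⊆ K_{U′}` is fixed by `a(u)`
  have hy' : a γ (a γ⁻¹ y) = y := by rw [← AlgEquiv.mul_apply, ← map_mul, mul_inv_cancel, map_one, AlgEquiv.one_apply]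
  have hmem : a γ (a γ⁻¹ y) ∈ fixFld p a ((CosetCat.equivConnectedPart hΓ).inverse.obj Y').sg := hγ _ (hEnorm _ _ hy)
  rw [← hy']
  exact (mem_fixFld_iff p a _ _).mp hmem u hu


/-! ## §2 At the hull: cyclic `N`-torsion and `N`-th roots of constants over every object whose Galois image fixes `E_N` -/

variable (R S : ((ConnectedPart (BTemp Γ))ᵒᵖ ⥤ CommMonCat.{0}) → Prop)

/-- **Cyclic `N`-torsion over an `E_N`-fixing object**: if `a(U_Y) ≤ Gal(ℚ̄_p/E_N(K₀))` then `K_{U_Y} ∋ ζ_N` and the `N`-torsion of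
`Ker Div_B(Y)` is cyclic of order `N`, generated by the constant function `ζ_N` (the argument of `cyclotomicLaw`, at THIS object).
[cite: MochizukiEtTh2009, Prop 4.2 (iii) p.315 (PDF p.89)] -/
theorem cyclic_torsion_of_map_le_fixingSubgroup (K₀ : IntermediateField ℚ_[p] (PadicAlgCl p)) (N : ℕ+) (Y : ConnectedPart (BTemp Γ))
    (hfix : ((((equiv hΓ).inverse.obj Y).sg.toSubgroup.map a : Subgroup (GQp p)) ≤
      (IntermediateField.normalClosure ℚ_[p]
        (IntermediateField.adjoin ℚ_[p] ((K₀ : Set (PadicAlgCl p)) ∪ {x | x ^ (N : ℕ) ∈ K₀})) (PadicAlgCl p)).fixingSubgroup)) :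
    ∃ ζ : ((temperedFrobenioid p a ha hΓ R S).ratFnFunctor.obj (op Y))ˣ,
      divB (temperedFrobenioid p a ha hΓ R S).divisorMonoid (temperedFrobenioid p a ha hΓ R S).ratFnFunctor
          (temperedFrobenioid p a ha hΓ R S).divBNatTrans (op Y)
          (ζ : (temperedFrobenioid p a ha hΓ R S).ratFnFunctor.obj (op Y)) = 1 ∧
        orderOf ζ = (N : ℕ) ∧
        ∀ u : ((temperedFrobenioid p a ha hΓ R S).ratFnFunctor.obj (op Y))ˣ,
          divB (temperedFrobenioid p a ha hΓ R S).divisorMonoid (temperedFrobenioid p a ha hΓ R S).ratFnFunctor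
              (temperedFrobenioid p a ha hΓ R S).divBNatTrans (op Y)
              (u : (temperedFrobenioid p a ha hΓ R S).ratFnFunctor.obj (op Y)) = 1 →
            u ^ (N : ℕ) = 1 → u ∈ Subgroup.zpowers ζ := by
  -- a primitive `N`-th root of unity among the constants of `Y`
  haveI : NeZero ((N : ℕ) : PadicAlgCl p) := ⟨by exact_mod_cast N.ne_zero⟩
  obtain ⟨ζ₀, hζ₀⟩ : ∃ ζ₀ : PadicAlgCl p, IsPrimitiveRoot ζ₀ (N : ℕ) := HasEnoughRootsOfUnity.prim
  obtain ⟨ζ, hζ, hζU⟩ : ∃ ζ : (PadicAlgCl p)ˣ, IsPrimitiveRoot ζ (N : ℕ) ∧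
      (ζ : PadicAlgCl p) ∈ fixFld p a ((equiv hΓ).inverse.obj Y).sg := by
    refine ⟨(hζ₀.isUnit N.ne_zero).unit, hζ₀.isUnit_unit N.ne_zero, ?_⟩
    rw [IsUnit.unit_spec]
    exact le_fixFld_of_map_le_fixingSubgroup p a _ hfix (mem_normalClosure_adjoin_of_pow_eq_one p K₀ N hζ₀.pow_eq_one)
  -- the dictionary `B₀(Γ/U) ≅ B(Y)` of the engine, on units
  let e : eqvFun p a ((equiv hΓ).inverse.obj Y) ≃* (temperedFrobenioid p a ha hΓ R S).ratFnFunctor.obj (op Y) :=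
    TemperedFrobenioid.RankOneBase.ratFnEquiv (hpf p a ha) (rankOneBase p a ha hΓ)
      QuasiTemperoid.BTempConnected.connectedPart_isConnected QuasiTemperoid.BTempConnected.connectedPart_isTotallyEpimorphic
      QuasiTemperoid.BTempConnected.connectedPart_isOfFSMType R S (op Y)
  let eU : eqvFun p a ((equiv hΓ).inverse.obj Y) ≃* ((temperedFrobenioid p a ha hΓ R S).ratFnFunctor.obj (op Y))ˣ :=
    toUnits.trans (Units.mapEquiv e)
  have hordb : orderOf (ofFixed p a ((equiv hΓ).inverse.obj Y) ζ hζU) = (N : ℕ) := by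
    rw [orderOf_ofFixed]; exact hζ.eq_orderOf.symm
  have hbN : ofFixed p a ((equiv hΓ).inverse.obj Y) ζ hζU ^ (N : ℕ) = 1 := by
    rw [← hordb]; exact pow_orderOf_eq_one _
  refine ⟨eU (ofFixed p a ((equiv hΓ).inverse.obj Y) ζ hζU), ?_, ?_, ?_⟩
  · change gpMap (TemperedFrobenioid.RankOneBase.toPfImage (hpf p a ha) (rankOneBase p a ha hΓ) (op Y))
        (divZero p a ha ((equiv hΓ).inverse.obj Y) (ofFixed p a ((equiv hΓ).inverse.obj Y) ζ hζU)) = 1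
    rw [divZero_eq_one_of_pow_eq_one p a ha _ _ N.pos hbN]
    exact map_one _
  · rw [MulEquiv.orderOf_eq, hordb]
  · intro u _ hu
    obtain ⟨i, hi⟩ := exists_ofFixed_pow_eq_of_pow_eq_one p a ((equiv hΓ).inverse.obj Y) hζ hζU (eU.symm u)
      (by rw [← map_pow, hu, map_one])
    have hu' : u = eU (ofFixed p a ((equiv hΓ).inverse.obj Y) ζ hζU) ^ i := by
      rw [← map_pow, hi, MulEquiv.apply_symm_apply]
    rw [hu']
    exact Subgroup.npow_mem_zpowers _ _

/-- **`N`-th ROOTS OF CONSTANTS over an `E_N`-fixing object (the hypothesis `hL` of Prop. 4.2 (iv), G-w4d044-1, as a THEOREM at the hull)**: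
if `a(U_A) ≤ Gal(ℚ̄_p/E_N(K_{U₀}))` then along EVERY `g : A^{bs} → Γ/U₀` every rational function `ξ ∈ B(Γ/U₀) ≅ K_{U₀}^×` becomes an
`N`-th power in `B(A^{bs})` — the root being the constant `a(h)·c^{1/N} ∈ E_N ⊆ K_{U_A}` (`h·U₀` the base point of `g`; identity checked at
the base point through the engine dictionary `B₀ ≅ B`, `ratFnOfBZero_natural`, `ev_pullFun`).  (The divisor hypothesis of `hL` is not needed:
ALL constants acquire roots.)  [cite: MochizukiEtTh2009, Prop 4.2 (iv) p.315 (PDF p.89); Def 5.4 p.327 (PDF p.101)] -/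
theorem exists_pow_eq_pull_of_map_le_fixingSubgroup (N : ℕ+) (A₀ A : ConnectedPart (BTemp Γ))
    (hfix : ((((equiv hΓ).inverse.obj A).sg.toSubgroup.map a : Subgroup (GQp p)) ≤
      (IntermediateField.normalClosure ℚ_[p]
        (IntermediateField.adjoin ℚ_[p] ((fixFld p a ((equiv hΓ).inverse.obj A₀).sg : Set (PadicAlgCl p)) ∪
          {x | x ^ (N : ℕ) ∈ fixFld p a ((equiv hΓ).inverse.obj A₀).sg})) (PadicAlgCl p)).fixingSubgroup))
    (g : A ⟶ A₀) (ξ : (temperedFrobenioid p a ha hΓ R S).ratFnFunctor.obj (op A₀)) :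
    ∃ ζ : (temperedFrobenioid p a ha hΓ R S).ratFnFunctor.obj (op A),
      ζ ^ (N : ℕ) = pull (temperedFrobenioid p a ha hΓ R S).ratFnFunctor g ξ := by
  let e₀ : eqvFun p a ((equiv hΓ).inverse.obj A₀) ≃* (temperedFrobenioid p a ha hΓ R S).ratFnFunctor.obj (op A₀) :=
    TemperedFrobenioid.RankOneBase.ratFnEquiv (hpf p a ha) (rankOneBase p a ha hΓ)
      QuasiTemperoid.BTempConnected.connectedPart_isConnected QuasiTemperoid.BTempConnected.connectedPart_isTotallyEpimorphic
      QuasiTemperoid.BTempConnected.connectedPart_isOfFSMType R S (op A₀)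
  let e' : eqvFun p a ((equiv hΓ).inverse.obj A) ≃* (temperedFrobenioid p a ha hΓ R S).ratFnFunctor.obj (op A) :=
    TemperedFrobenioid.RankOneBase.ratFnEquiv (hpf p a ha) (rankOneBase p a ha hΓ)
      QuasiTemperoid.BTempConnected.connectedPart_isConnected QuasiTemperoid.BTempConnected.connectedPart_isTotallyEpimorphic
      QuasiTemperoid.BTempConnected.connectedPart_isOfFSMType R S (op A)
  set bx := e₀.symm ξ with hbx
  have hx : ξ = e₀ bx := (MulEquiv.apply_symm_apply e₀ ξ).symm
  -- the covering map in `CosetCat Γ` and its base point `h·U₀`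
  let f : (equiv hΓ).inverse.obj A ⟶ (equiv hΓ).inverse.obj A₀ := (equiv hΓ).inverse.map g
  obtain ⟨h, hh⟩ := CosetCat.exists_smul_one_eq _ (CosetCat.pt f)
  have hh' : CosetCat.pt f = ((h : Γ) : ((equiv hΓ).inverse.obj A₀).carrier) := by
    rw [← hh, MulAction.Quotient.smul_coe, smul_eq_mul, mul_one]
  -- the constant `c = ev bx ∈ K_{U₀}`, an `N`-th root `z₀`, and the translate `a(h)·z₀ ∈ E_N ⊆ K_{U_A}`
  obtain ⟨z₀, hz₀⟩ := IsAlgClosed.exists_pow_nat_eq (((ev p a _ bx : (PadicAlgCl p)ˣ) : PadicAlgCl p)) N.pos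
  have hz0 : a h z₀ ≠ 0 := by
    rw [map_ne_zero_iff _ (a h).injective]
    intro h0
    rw [h0, zero_pow N.ne_zero] at hz₀
    exact (ev p a _ bx).ne_zero hz₀.symm
  have hzmem : ((Units.mk0 (a h z₀) hz0 : (PadicAlgCl p)ˣ) : PadicAlgCl p) ∈ fixFld p a ((equiv hΓ).inverse.obj A).sg := by
    rw [Units.val_mk0]
    exact le_fixFld_of_map_le_fixingSubgroup p a _ hfix
      (smul_mem_normalClosure_adjoin_of_pow_mem p _ N (a h) (by rw [hz₀]; exact ev_mem_fixFld p a _ bx))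
  refine ⟨e' (ofFixed p a ((equiv hΓ).inverse.obj A) (Units.mk0 (a h z₀) hz0) hzmem), ?_⟩
  -- naturality of the dictionary: `pull g (e₀ bx) = e' (pullFun f bx)`
  have hnat : pull (temperedFrobenioid p a ha hΓ R S).ratFnFunctor g (e₀ bx) = e' (pullFun p a f bx) :=
    TemperedFrobenioid.RankOneBase.ratFnOfBZero_natural (hpf p a ha) (rankOneBase p a ha hΓ)
      QuasiTemperoid.BTempConnected.connectedPart_isConnected QuasiTemperoid.BTempConnected.connectedPart_isTotallyEpimorphic
      QuasiTemperoid.BTempConnected.connectedPart_isOfFSMType R S g.op bx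
  rw [hx, hnat, ← map_pow]
  congr 1
  -- check at the base point: `(a(h)·z₀)^N = a(h)·c`
  apply ev_injective p a
  rw [map_pow, ev_ofFixed, ev_pullFun p a f bx hh']
  apply Units.ext
  rw [Units.val_pow_eq_pow_val, Units.val_mk0, ← map_pow, hz₀]
  rfl

end Hull

/-! ## §3 [EtTh] Prop. 4.2 (iii) ∧ (iv) AS TYPED at the hull over `B^temp(Π^tp_X)⁰` with the Def. 5.4 FIXING slot -/

section Setting4

variable (p : ℕ) [Fact p.Prime] {K : Type} [Field K] (X : TemperedArithmeticGroup.{0} K) (a : X.Pi →* GQp p)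
  (ha : ∀ U : OpenSubgroup X.Pi, IsOpen ((U.toSubgroup.map a : Subgroup (GQp p)) : Set (GQp p)))
  (R S : ((ConnectedPart (BTemp X.Pi))ᵒᵖ ⥤ CommMonCat.{0}) → Prop)

/-- **[EtTh] Prop. 4.2 (iii) AND (iv) AS TYPED AT THE BASE-FIELD-THEORETIC HULL over the genuine base `B^temp(Π^tp_X)⁰`, with the
CONTENTFUL Def. 5.4 `(N, H_⊙^{bs-fld})`-slot «`A` is `(N,H)`-good iff the Galois image `a(U_A)` of its base FIXES the (normal) Kummer field
`E_N ⊇ J_N = K_⊙((K_⊙^×)^{1/N})`, `K_⊙ := K_{A_⊙^{bs}}`» (print: «theta-saturated … `K(μ_N, …)`», Def. 5.4; `J_N`, §1 p.240)**: for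
abc-iut-L2-t4's §4 setting `mkOfConnectedTemperoid X (BsFldHull.temperedFrobenioid …) rfl hP NH A_⊙ …` BOTH typed clauses
`BiKummerSetting.Prop42_iii` (N-th-root objects EXIST and are `(N,H)`-good) and `BiKummerSetting.Prop42_iv` (N-th roots of fraction pairs are
unique up to `μ_N` and base-pinned isomorphisms) hold — EVERY binder of abc-iut-w4-d044's `prop42_iii_iv_mkOfModelCanonical_of_baseRootLaw`
(tree-vocabulary form, abc-iut-w6-d037) a THEOREM here: `hDSpull` + `hR₀ = BaseRootLaw «Galois»` (p508246), `hE` by abc-iut-w6-d037's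
`refinementLaw_mkOfModelCanonical_of_cyclotomicLaw` from the Kummer covering (`exists_galoisCover_map_le_fixingSubgroup` — THE SLOT IS
INHABITED — with `cyclic_torsion_of_map_le_fixingSubgroup`), `hS` (abc-iut-L2-t4), `hL` = `exists_pow_eq_pull_of_map_le_fixingSubgroup`.
[cite: MochizukiEtTh2009, Prop 4.2 (iii)(iv) p.314 (PDF p.88); Def 5.4 p.327 (PDF p.101)] -/
theorem prop42_iii_iv_mkOfConnectedTemperoid_fixingSlot (hcont : Continuous a)
    (A₀ : (temperedFrobenioid p a ha X.isTempered R S).category)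
    (hA₀ : PreFrobenioid.IsFrobeniusTrivial (temperedFrobenioid p a ha X.isTempered R S).toElem A₀) (hA₀' : IsGaloisObj A₀.base.obj) :
    (BiKummerSetting.mkOfConnectedTemperoid X (temperedFrobenioid p a ha X.isTempered R S) rfl (hP p a ha X.isTempered R S)
        (fun _ A M => ((((equiv X.isTempered).inverse.obj A.base).sg.toSubgroup.map a : Subgroup (GQp p)) ≤
          (IntermediateField.normalClosure ℚ_[p]
            (IntermediateField.adjoin ℚ_[p]
              ((fixFld p a ((equiv X.isTempered).inverse.obj A₀.base).sg : Set (PadicAlgCl p)) ∪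
                {x | x ^ (M : ℕ) ∈ fixFld p a ((equiv X.isTempered).inverse.obj A₀.base).sg})) (PadicAlgCl p)).fixingSubgroup))
        A₀ hA₀ hA₀').Prop42_iii
      (fun {_ _} φ x => (temperedFrobenioid p a ha X.isTempered R S).pullFracModel φ x) ∧
    (BiKummerSetting.mkOfConnectedTemperoid X (temperedFrobenioid p a ha X.isTempered R S) rfl (hP p a ha X.isTempered R S)
        (fun _ A M => ((((equiv X.isTempered).inverse.obj A.base).sg.toSubgroup.map a : Subgroup (GQp p)) ≤
          (IntermediateField.normalClosure ℚ_[p]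
            (IntermediateField.adjoin ℚ_[p]
              ((fixFld p a ((equiv X.isTempered).inverse.obj A₀.base).sg : Set (PadicAlgCl p)) ∪
                {x | x ^ (M : ℕ) ∈ fixFld p a ((equiv X.isTempered).inverse.obj A₀.base).sg})) (PadicAlgCl p)).fixingSubgroup))
        A₀ hA₀ hA₀').Prop42_iv
      (fun φ x => (temperedFrobenioid p a ha X.isTempered R S).pullFracModel φ x) := by
  -- `hE` ([FrdII] Rmk. 2.2.1 refinement to `μ_N`-saturated `(N,H)`-good objects) from the Kummer covering of §1 through
  -- abc-iut-w6-d037's `refinementLaw_mkOfModelCanonical_of_cyclotomicLaw` (Galois data of `mkOfConnectedTemperoid` spelled out)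
  have hE := BiKummerSetting.Prop42Sub.refinementLaw_mkOfModelCanonical_of_cyclotomicLaw X
    (temperedFrobenioid p a ha X.isTempered R S) rfl (hP p a ha X.isTempered R S) (fun A => IsGaloisObj A.obj)
    (fun A h => ((connectedObjects (BTemp X.Pi)).fullyFaithfulι.autMulEquivOfFullyFaithful A).symm.toMonoidHom.comp
      (GaloisObjects.galoisSurjOf X.isTempered A.obj h))
    (fun A h => by
      rw [MonoidHom.coe_comp]
      exact (MulEquiv.surjective _).comp (GaloisObjects.galoisSurjOf_surjective X.isTempered A.obj h))
    (fun _ A M => ((((equiv X.isTempered).inverse.obj A.base).sg.toSubgroup.map a : Subgroup (GQp p)) ≤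
          (IntermediateField.normalClosure ℚ_[p]
            (IntermediateField.adjoin ℚ_[p]
              ((fixFld p a ((equiv X.isTempered).inverse.obj A₀.base).sg : Set (PadicAlgCl p)) ∪
                {x | x ^ (M : ℕ) ∈ fixFld p a ((equiv X.isTempered).inverse.obj A₀.base).sg})) (PadicAlgCl p)).fixingSubgroup))
    A₀ hA₀ hA₀' (temperedFrobenioid p a ha X.isTempered R S).isDivisorial_divisorMonoid
    (fun N Y hY => by
      -- the cyclotomic covering law with the `(N,H)`-clause: the Kummer covering of `Y` for the constants of `A_⊙^{bs}`
      obtain ⟨Y', hY', c, hfix⟩ :=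
        exists_galoisCover_map_le_fixingSubgroup p a ha X.isTempered hcont N ((equiv X.isTempered).inverse.obj A₀.base).sg Y hY
      exact ⟨Y', hY', c, cyclic_torsion_of_map_le_fixingSubgroup p a ha X.isTempered R S _ N Y' hfix, fun _ => hfix⟩)
  exact BiKummerSetting.Prop42Sub.prop42_iii_iv_mkOfModelCanonical_of_baseRootLaw_treeCatVocabWeak X
    (temperedFrobenioid p a ha X.isTempered R S) rfl (hP p a ha X.isTempered R S) _ _ _ _ A₀ hA₀ hA₀'
    (hDSpull p a ha X.isTempered R S) (baseRootLaw p a ha X.isTempered R S hcont) hE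
    (BiKummerSetting.mkOfConnectedTemperoid_galoisSurj_natural X (temperedFrobenioid p a ha X.isTempered R S) rfl
      (hP p a ha X.isTempered R S) (fun _ _ _ => True) A₀ hA₀ hA₀')
    fun A'' N g ξ _ hNH _ => exists_pow_eq_pull_of_map_le_fixingSubgroup p a ha X.isTempered R S N A₀.base A''.base hNH g ξ

end Setting4

end BsFldHull

end Literature.AnabelianGeometry.EtaleTheta

end
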